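import Summits.HubbardSuperconductivity.HubbardSuperconductivity.Theorems.BalabanIRBirComplexStableXYStiffnessHolomorphy
import Summits.HubbardSuperconductivity.HubbardSuperconductivity.Theorems.BalabanIRBirComplexStableXYStiffnessAdmissible
import Summits.HubbardSuperconductivity.HubbardSuperconductivity.Theorems.BalabanIRBirComplexStableXYPartZApriori

/-!
# The cubic Berry family for the negative lane of `BalabanIR.BirComplexStableXY` (stmt-HubbardSuperconductivity-2080)

Prover seat c4-0 on the glue item stmt-HubbardSuperconductivity-2082 (`BirGappedPhaseReduction :=
BirComplexStableXY → BirGroundStateAverageLRO`, decided by the negative lane of stmt-2080), 2026-08-16.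
Support file (tables, admissibility, holomorphy, a-priori bound) for the negative lemma
`BirComplexStableXY_false_of_CubicModulusCrossing`
(`Theorems/BirComplexStableXY/Negative/BirComplexStableXYFalseOfCubicModulusCrossing.lean`).

## Why a new holomorphic family

All three hearts in the tree (`WitnessZeroExists`, `StiffTwoLevelStructure`, `StiffModulusCrossing`) complexify the
temporal cos-stiffness `a` of the table `spatialTab + a • temporalCosTab + (iε₂) • temporalSinTab` and aim at the
crossing of the charge sectors `q = 0` and `q = 1` of the slice transfer operator.  That crossing is DEGENERATE at
leading semiclassical order: by the exact gauge identity `a cos Δ + iε₂ sin Δ = R cos(Δ − iφ)`, `R = √(a² − ε₂²)`,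
`tanh φ = ε₂/a`, the dominant charge of the frozen slice is `q⋆ = K′ε₂ − ε₂/(2a) + O(1/K′)` (`K′ = 4KL²`), and the
0↔1 crossing value `ε_c(a)` satisfies `2K′ε_c(a) = 1 + O(1/(K′a))` for EVERY `a` — numerically `1.000417 … 1.000250`
over `a ∈ [3/4, 5/4]` at `K′ = 1600` (session numerics `rotor_sectors.py`, evidence on stmt-2082).  So whether the two
ends of an admissible `a`-ball sit on opposite sides of the crossing is decided at relative order `1e-4`, far below the
spin-wave renormalisation of the slab's rotor constant (relative `O(log L/(K b))`).

The present family deforms instead a CUBIC, time-odd, purely imaginary temporal term,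
`cubicTab ε₂ ζ = spatialTab + 1 • temporalCosTab + (iε₂) • temporalSinTab + (iζ) • temporalSin3Tab`,
`temporalSin3Tab = Σ_{4 temporal edges} (sin 3Δ − 3 sin Δ) = Σ (−4 sin³ Δ)`.  Because `sin 3Δ − 3 sin Δ` vanishes to
third order at `Δ = 0` and `|4 sin³ Δ| ≤ 8 (1 − cos Δ)` (`abs_sin_three_mul_sub_le`), the table stays ADMISSIBLE for
COMPLEX `ζ` with `|Im ζ| ≤ 1/32` (coercivity `c₀ = 1/24` unchanged), `|Re ζ| ≤ 1/4`, `|ε₂| ≤ 1/5`, budget `B = 1024`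
(`cubicTab_admissible`), and `ζ ↦ Z` is entire (`differentiable_partZ_cubic`).  Along REAL `ζ` the table is
time-reflective and the dominant charge moves at LEADING order: the saddle-point prefactor gives
`q⋆(ζ) = K′ε₂ − (ε₂ + 24 ζ)/(2a) + O(1/K′)`, slope `−12/a` per unit `ζ` (numerics `K′ = 400`, `a = 1`, `ε₂ = 1/5`:
argmax sector `82, 81, 80, 80, 79, 79, 78` at `ζ = −0.15 … 0.15`, continuous maximiser within `0.03` of the formula).
Hence the admissible real diameter `|Re ζ| ≤ 1/4` carries at least five modulus crossings of charge sectors,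
robustly in `K′` and under any `ζ`-independent shift of `q⋆` (such as the spin-wave shift `O(L² ε₂ log L / b)`).

Contents: `sin3Tab`, `temporalSin3Tab`, `cubicTab`; evaluation lemmas; `cubicTab_admissible` ((U1), (N), (A) with
`B = 1024`, (C) with `c₀ = 1/24`); `differentiable_partZ_cubic`; `norm_partZ_le_exp_of_normA_le` (the a-priori bound
`‖Z_M‖ ≤ exp(M·|(ℤ/L)²|·(B|K| + log 2π))` for any budget `B`).
-/

namespace Summit.HubbardSuperconductivity.BirComplexStableXYNegative

open scoped BigOperators Topology
open MeasureTheory Metric Filter Literature.Probability.LatticeModels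
open Summit.HubbardSuperconductivity.HubbardSuperconductivity.Theses.BalabanIR

noncomputable section

/-! ### The cubic time-odd table `sin 3Δ − 3 sin Δ = −4 sin³ Δ` -/

/-- Fourier table of `sin(3(φ_u − φ_v)) − 3 sin(φ_u − φ_v) = −4 sin³(φ_u − φ_v)` (time-odd, vanishing to third
order at coincident phases). -/
def sin3Tab (u v : W 2) : Table 2 :=
  Finsupp.single ((3 : ℤ) • dfreq u v) (-(Complex.I / 2)) + Finsupp.single ((3 : ℤ) • dfreq v u) (Complex.I / 2) +
    (-3 : ℂ) • sinTab u v

/-- temporal cubic part: `Σ_{4 temporal edges} (sin 3Δ_eφ − 3 sin Δ_eφ)`. -/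
def temporalSin3Tab : Table 2 := (temporalEdges.map fun e => sin3Tab e.1 e.2).sum

/-- THE CUBIC BERRY FAMILY `c(ε₂, ζ) = spatialTab + 1 • temporalCosTab + (iε₂) • temporalSinTab + (iζ) • temporalSin3Tab`
(`ε₂` real, `ζ` the complex deformation parameter). -/
def cubicTab (ε₂ : ℝ) (ζ : ℂ) : Table 2 :=
  (spatialTab + (1 : ℂ) • temporalCosTab + (Complex.I * ε₂) • temporalSinTab) + (Complex.I * ζ) • temporalSin3Tab

/-! ### Evaluation lemmas for the tripled frequency -/

/-- `(3(δ_u − δ_v))·φ = 3(φ_u − φ_v)`. -/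
theorem sum_three_smul_dfreq_mul (u v : W 2) (φ : W 2 → ℝ) :
    (∑ w, ((((3 : ℤ) • dfreq u v) w : ℤ) : ℝ) * φ w) = 3 * (φ u - φ v) := by
  have h : ∀ w, ((((3 : ℤ) • dfreq u v) w : ℤ) : ℝ) * φ w = 3 * (((dfreq u v w : ℤ) : ℝ) * φ w) := by
    intro w
    simp only [Pi.smul_apply, smul_eq_mul, Int.cast_mul, Int.cast_ofNat]
    ring
  simp_rw [h]
  rw [← Finset.mul_sum, sum_dfreq_mul]

/-- the character of `3(δ_u − δ_v)` is `e^{3i(φ_u − φ_v)}`. -/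
theorem ch_three_smul_dfreq (u v : W 2) (φ : W 2 → ℝ) :
    ch ((3 : ℤ) • dfreq u v) φ = Complex.exp (Complex.I * ((3 * (φ u - φ v) : ℝ) : ℂ)) := by
  rw [ch, sum_three_smul_dfreq_mul]

/-- `3(δ_u − δ_v)` is charge neutral. -/
theorem sum_three_smul_dfreq (u v : W 2) : ∑ w, ((3 : ℤ) • dfreq u v) w = 0 := by
  simp only [Pi.smul_apply, smul_eq_mul, ← Finset.mul_sum, sum_dfreq, mul_zero]

/-- `|3(δ_u − δ_v)|₁ = 6` for `u ≠ v`. -/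
theorem sum_abs_three_smul_dfreq {u v : W 2} (h : u ≠ v) :
    (∑ w, |((((3 : ℤ) • dfreq u v) w : ℤ) : ℝ)|) = 6 := by
  have hw : ∀ w, |((((3 : ℤ) • dfreq u v) w : ℤ) : ℝ)| = 3 * |((dfreq u v w : ℤ) : ℝ)| := by
    intro w
    simp only [Pi.smul_apply, smul_eq_mul, Int.cast_mul, Int.cast_ofNat, abs_mul]
    norm_num
  simp_rw [hw]
  rw [← Finset.mul_sum, sum_abs_dfreq h]
  norm_num

/-- `F(sin3Tab u v) = sin 3(φ_u − φ_v) − 3 sin(φ_u − φ_v)`. -/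
theorem genF_sin3Tab (u v : W 2) (φ : W 2 → ℝ) :
    genF (sin3Tab u v) φ = ((Real.sin (3 * (φ u - φ v)) - 3 * Real.sin (φ u - φ v) : ℝ) : ℂ) := by
  have e1 : ch ((3 : ℤ) • dfreq u v) φ = Complex.exp (((3 * (φ u - φ v) : ℝ) : ℂ) * Complex.I) := by
    rw [ch_three_smul_dfreq, mul_comm]
  have e2 : ch ((3 : ℤ) • dfreq v u) φ = Complex.exp (-((3 * (φ u - φ v) : ℝ) : ℂ) * Complex.I) := by
    rw [ch_three_smul_dfreq]; congr 1; push_cast; ring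
  have h2 := Complex.two_sin ((3 * (φ u - φ v) : ℝ) : ℂ)
  simp only [sin3Tab, genF_add, genF_smul, genF_single, genF_sinTab, e1, e2]
  push_cast at h2 ⊢
  linear_combination (-1/2 : ℂ) * h2

/-- `sin 3x − 3 sin x = −4 sin³ x`. -/
theorem sin_three_mul_sub (x : ℝ) : Real.sin (3 * x) - 3 * Real.sin x = -4 * Real.sin x ^ 3 := by
  rw [Real.sin_three_mul]; ring

/-- the cubic term is dominated by the cosine penalty: `|sin 3x − 3 sin x| ≤ 8(1 − cos x)`
(`4|sin x|³ = 4|sin x|(1 − cos x)(1 + cos x)`). -/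
theorem abs_sin_three_mul_sub_le (x : ℝ) : |Real.sin (3 * x) - 3 * Real.sin x| ≤ 8 * (1 - Real.cos x) := by
  rw [sin_three_mul_sub]
  have hs : Real.sin x ^ 2 = (1 - Real.cos x) * (1 + Real.cos x) := by
    have := Real.sin_sq_add_cos_sq x; nlinarith
  have h1 : |Real.sin x| ≤ 1 := Real.abs_sin_le_one x
  have h2 : 0 ≤ 1 - Real.cos x := sub_nonneg.2 (Real.cos_le_one x)
  have h3 : 1 + Real.cos x ≤ 2 := by have := Real.cos_le_one x; linarith
  have h4 : 0 ≤ 1 + Real.cos x := by have := Real.neg_one_le_cos x; linarith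
  rw [show -4 * Real.sin x ^ 3 = (-4 * Real.sin x) * Real.sin x ^ 2 by ring, abs_mul, hs]
  rw [abs_of_nonneg (mul_nonneg h2 h4), abs_mul, abs_neg, show |(4:ℝ)| = 4 by norm_num]
  have h5 : |Real.sin x| * ((1 - Real.cos x) * (1 + Real.cos x)) ≤ 1 * ((1 - Real.cos x) * 2) := by
    apply mul_le_mul h1 _ (mul_nonneg h2 h4) zero_le_one
    exact mul_le_mul_of_nonneg_left h3 h2
  nlinarith [abs_nonneg (Real.sin x)]

/-- `sin3Tab` vanishes at constants ((N)). -/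
theorem tsum_sin3Tab (u v : W 2) : tsum (sin3Tab u v) = 0 := by
  simp only [sin3Tab, tsum_add, tsum_single, tsum_smul, tsum_sinTab]; ring

/-- `sin3Tab` is `U(1)` invariant. -/
theorem condU1_sin3Tab (u v : W 2) : (∀ m ∈ (sin3Tab u v).support, ∑ w, m w = 0) :=
  condU1_add (condU1_add (condU1_single (sum_three_smul_dfreq u v) _)
    (condU1_single (sum_three_smul_dfreq v u) _)) (condU1_smul _ (condU1_sinTab u v))

/-- weighted norm of `sin3Tab u v` is at most `e⁶ + 3e²`. -/
theorem normA_sin3Tab {u v : W 2} (h : u ≠ v) : normA (sin3Tab u v) ≤ Real.exp 6 + 3 * Real.exp 2 := by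
  have h' : v ≠ u := fun e => h e.symm
  have e1 : normA (Finsupp.single ((3 : ℤ) • dfreq u v) (-(Complex.I / 2))) = (1/2) * Real.exp 6 := by
    rw [normA_single, sum_abs_three_smul_dfreq h]; simp
  have e2 : normA (Finsupp.single ((3 : ℤ) • dfreq v u) (Complex.I / 2)) = (1/2) * Real.exp 6 := by
    rw [normA_single, sum_abs_three_smul_dfreq h']; simp
  have e3 : normA ((-3 : ℂ) • sinTab u v) ≤ 3 * Real.exp 2 := by
    rw [normA_smul]
    have : ‖(-3 : ℂ)‖ = 3 := by simp
    rw [this]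
    exact mul_le_mul_of_nonneg_left (normA_sinTab h) (by norm_num)
  have s1 := normA_add_le (Finsupp.single ((3 : ℤ) • dfreq u v) (-(Complex.I / 2)) +
    Finsupp.single ((3 : ℤ) • dfreq v u) (Complex.I / 2)) ((-3 : ℂ) • sinTab u v)
  have s2 := normA_add_le (Finsupp.single ((3 : ℤ) • dfreq u v) (-(Complex.I / 2)))
    (Finsupp.single ((3 : ℤ) • dfreq v u) (Complex.I / 2))
  unfold sin3Tab
  linarith

/-- a list sum of `sin3Tab`s is `U(1)` invariant. -/
theorem condU1_map_sin3Tab (l : List (W 2 × W 2)) :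
    (∀ m ∈ ((l.map fun e => sin3Tab e.1 e.2).sum).support, ∑ w, m w = 0) :=
  condU1_list_sum _ fun c hc => by
    obtain ⟨e, -, rfl⟩ := List.mem_map.1 hc
    exact condU1_sin3Tab _ _

/-- `F` of a list sum of `sin3Tab`s is the real number `Σ (sin 3Δφ − 3 sin Δφ)`. -/
theorem genF_map_sin3Tab (l : List (W 2 × W 2)) (φ : W 2 → ℝ) :
    genF ((l.map fun e => sin3Tab e.1 e.2).sum) φ =
      (((l.map fun e => (Real.sin (3 * (φ e.1 - φ e.2)) - 3 * Real.sin (φ e.1 - φ e.2))).sum : ℝ) : ℂ) := by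
  induction l with
  | nil => simp [genF_zero]
  | cons e l ih => simp [List.sum_cons, genF_add, genF_sin3Tab, ih]

/-- the cubic list sum is dominated by `8 ×` the cosine list sum, in absolute value. -/
theorem abs_sum_map_sin3_le (l : List (W 2 × W 2)) (φ : W 2 → ℝ) :
    |(l.map fun e => (Real.sin (3 * (φ e.1 - φ e.2)) - 3 * Real.sin (φ e.1 - φ e.2))).sum| ≤
      8 * (l.map fun e => (1 - Real.cos (φ e.1 - φ e.2))).sum := by
  induction l with
  | nil => simp
  | cons e l ih =>
    simp only [List.map_cons, List.sum_cons]
    have h1 := abs_sin_three_mul_sub_le (φ e.1 - φ e.2)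
    calc _ ≤ |Real.sin (3 * (φ e.1 - φ e.2)) - 3 * Real.sin (φ e.1 - φ e.2)| +
          |(l.map fun e => (Real.sin (3 * (φ e.1 - φ e.2)) - 3 * Real.sin (φ e.1 - φ e.2))).sum| :=
          abs_add_le _ _
      _ ≤ _ := by linarith

/-! ### The cubic temporal table -/

/-- weighted norm of the temporal cubic part `≤ 4(e⁶ + 3e²)`. -/
theorem normA_temporalSin3Tab : normA temporalSin3Tab ≤ 4 * (Real.exp 6 + 3 * Real.exp 2) := by
  refine (normA_list_sum_le _).trans ?_
  simp only [temporalEdges, List.map_cons, List.map_nil, List.sum_cons, List.sum_nil]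
  have h1 := normA_sin3Tab (u := vx 0 0 1) (v := vx 0 0 0) (by decide)
  have h2 := normA_sin3Tab (u := vx 0 1 1) (v := vx 0 1 0) (by decide)
  have h3 := normA_sin3Tab (u := vx 1 0 1) (v := vx 1 0 0) (by decide)
  have h4 := normA_sin3Tab (u := vx 1 1 1) (v := vx 1 1 0) (by decide)
  simp only [vx] at h1 h2 h3 h4 ⊢
  linarith

/-- `temporalSin3Tab` vanishes at constants. -/
theorem tsum_temporalSin3Tab : tsum temporalSin3Tab = 0 := by
  simp only [temporalSin3Tab, temporalEdges, List.map_cons, List.map_nil, List.sum_cons, List.sum_nil,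
    tsum_add, tsum_sin3Tab, add_zero]

/-- `e⁶ < 404`. -/
theorem exp_six_lt : Real.exp 6 < 404 := by
  have h := exp_two_lt
  have h0 := Real.exp_pos 2
  have h6 : Real.exp 6 = Real.exp 2 * Real.exp 2 * Real.exp 2 := by
    rw [← Real.exp_add, ← Real.exp_add]; norm_num
  rw [h6]
  have h4 : Real.exp 2 * Real.exp 2 < 7.3891 * 7.3891 := by nlinarith
  nlinarith

/-! ### Admissibility of the cubic family -/

/-- (U1) for the cubic family. -/
theorem cubicTab_condU1 (ε₂ : ℝ) (ζ : ℂ) : (∀ m ∈ (cubicTab ε₂ ζ).support, ∑ w, m w = 0) :=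
  condU1_add (stiffAdm_condU1 1 ε₂) (condU1_smul _ (condU1_map_sin3Tab _))

/-- (N) for the cubic family. -/
theorem cubicTab_condN (ε₂ : ℝ) (ζ : ℂ) : (cubicTab ε₂ ζ).sum (fun _ c => c) = 0 := by
  change tsum (cubicTab ε₂ ζ) = 0
  have h1 : tsum (spatialTab + (1 : ℂ) • temporalCosTab + (Complex.I * ε₂) • temporalSinTab) = 0 :=
    stiffAdm_condN 1 ε₂
  rw [cubicTab, tsum_add, h1, tsum_smul]
  change 0 + Complex.I * ζ * tsum temporalSin3Tab = 0
  rw [tsum_temporalSin3Tab]; ring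

/-- `‖ζ‖ ≤ 9/32` on the admissible rectangle `|Re ζ| ≤ 1/4`, `|Im ζ| ≤ 1/32`. -/
theorem norm_le_of_rect {ζ : ℂ} (h1 : |ζ.re| ≤ 1/4) (h2 : |ζ.im| ≤ 1/32) : ‖ζ‖ ≤ 9/32 := by
  have := Complex.norm_le_abs_re_add_abs_im ζ
  linarith

/-- (A) for the cubic family: `normA ≤ 128 + (9/32)·4(e⁶ + 3e²) < 1024`. -/
theorem cubicTab_condA {ε₂ : ℝ} {ζ : ℂ} (hε : |ε₂| ≤ 1/5) (h1 : |ζ.re| ≤ 1/4) (h2 : |ζ.im| ≤ 1/32) :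
    normA (cubicTab ε₂ ζ) ≤ 1024 := by
  have hbase : normA (spatialTab + (1 : ℂ) • temporalCosTab + (Complex.I * ε₂) • temporalSinTab) ≤ 128 :=
    stiffAdm_condA (a := 1) (by simp) hε
  have h3 := normA_temporalSin3Tab
  have h3n := normA_nonneg temporalSin3Tab
  have hz := norm_le_of_rect h1 h2
  have hIz : ‖Complex.I * ζ‖ ≤ 9/32 := by simpa using hz
  have he2 := exp_two_lt
  have he6 := exp_six_lt
  have s := normA_add_le (spatialTab + (1 : ℂ) • temporalCosTab + (Complex.I * ε₂) • temporalSinTab)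
    ((Complex.I * ζ) • temporalSin3Tab)
  rw [normA_smul] at s
  have b : ‖Complex.I * ζ‖ * normA temporalSin3Tab ≤ (9/32) * (4 * (Real.exp 6 + 3 * Real.exp 2)) :=
    mul_le_mul hIz h3 h3n (by norm_num)
  unfold cubicTab
  linarith

/-- real part of `F` of the cubic family: `S_spatial + T_cos − (Im ζ) · G₃` with `G₃` the cubic list sum. -/
theorem cubicTab_genF_re (ε₂ : ℝ) (ζ : ℂ) (φ : W 2 → ℝ) :
    (genF (cubicTab ε₂ ζ) φ).re =
      (spatialEdges.map fun e => (1 - Real.cos (φ e.1 - φ e.2))).sum +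
        (temporalEdges.map fun e => (1 - Real.cos (φ e.1 - φ e.2))).sum -
        ζ.im * (temporalEdges.map fun e =>
          (Real.sin (3 * (φ e.1 - φ e.2)) - 3 * Real.sin (φ e.1 - φ e.2))).sum := by
  rw [cubicTab, genF_add, Complex.add_re, stiffAdm_genF_re, genF_smul, temporalSin3Tab, genF_map_sin3Tab]
  simp only [Complex.mul_re, Complex.mul_im, Complex.I_re, Complex.I_im, Complex.ofReal_re, Complex.ofReal_im,
    Complex.one_re]
  ring

/-- (C) COERCIVITY of the cubic family with `c₀ = 1/24` on `|Im ζ| ≤ 1/32`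
(`|Im ζ| · |G₃| ≤ (1/32) · 8 · T_cos = T_cos/4`, then `S + (3/4) T ≥ (3/4) S12 ≥ (3/4)(1/18) ΣΣ`). -/
theorem cubicTab_condC {ζ : ℂ} (h2 : |ζ.im| ≤ 1/32) (ε₂ : ℝ) (φ : W 2 → ℝ) :
    (1/24 : ℝ) * ∑ w, ∑ w', (1 - Real.cos (φ w - φ w')) ≤ (genF (cubicTab ε₂ ζ) φ).re := by
  have hC := condC_witness 0 0 φ
  rw [genF_witness_re, stiffAdm_S12_eq] at hC
  rw [cubicTab_genF_re]
  set S := (spatialEdges.map fun e => (1 - Real.cos (φ e.1 - φ e.2))).sum with hS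
  set T := (temporalEdges.map fun e => (1 - Real.cos (φ e.1 - φ e.2))).sum with hT
  set G := (temporalEdges.map fun e =>
    (Real.sin (3 * (φ e.1 - φ e.2)) - 3 * Real.sin (φ e.1 - φ e.2))).sum with hG
  have hS0 : 0 ≤ S := stiffAdm_sum_one_sub_cos_nonneg spatialEdges φ
  have hT0 : 0 ≤ T := stiffAdm_sum_one_sub_cos_nonneg temporalEdges φ
  have hGT : |G| ≤ 8 * T := abs_sum_map_sin3_le temporalEdges φ
  have hprod : |ζ.im * G| ≤ (1/32) * (8 * T) := by
    rw [abs_mul]; exact mul_le_mul h2 hGT (abs_nonneg _) (by norm_num)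
  have hlow : -(ζ.im * G) ≥ -((1/32) * (8 * T)) := by
    have := neg_abs_le (ζ.im * G)
    linarith [le_abs_self (ζ.im * G)]
  nlinarith

/-- ADMISSIBILITY of the cubic Berry family `cubicTab ε₂ ζ` on `|ε₂| ≤ 1/5`, `|Re ζ| ≤ 1/4`, `|Im ζ| ≤ 1/32`:
the crux's hypotheses (U1), (N), (A) with `B = 1024`, (C) with `c₀ = 1/24`. -/
theorem cubicTab_admissible (ε₂ : ℝ) (ζ : ℂ) (hε : |ε₂| ≤ 1/5) (h1 : |ζ.re| ≤ 1/4) (h2 : |ζ.im| ≤ 1/32) :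
    (∀ m ∈ (cubicTab ε₂ ζ).support, ∑ w, m w = 0) ∧
    (cubicTab ε₂ ζ).sum (fun _ c => c) = 0 ∧
    (cubicTab ε₂ ζ).sum (fun n c => ‖c‖ * Real.exp (∑ w, |(n w : ℝ)|)) ≤ 1024 ∧
    (∀ φ : W 2 → ℝ, (1/24 : ℝ) * ∑ w, ∑ w', (1 - Real.cos (φ w - φ w')) ≤ (genF (cubicTab ε₂ ζ) φ).re) :=
  ⟨cubicTab_condU1 ε₂ ζ, cubicTab_condN ε₂ ζ, cubicTab_condA hε h1 h2, fun φ => cubicTab_condC h2 ε₂ φ⟩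

/-! ### Holomorphy in `ζ` and the a-priori bound -/

/-- the cubic action is affine in `ζ`. -/
theorem action_cubicTab_eq (K ε₂ : ℝ) (L M : ℕ) [NeZero L] [NeZero M] (ζ : ℂ) (θ : Λ L M → ℝ) :
    action K (cubicTab ε₂ ζ) L M θ =
      action K (spatialTab + (1 : ℂ) • temporalCosTab + (Complex.I * ε₂) • temporalSinTab) L M θ
        + ζ * (Complex.I * action K temporalSin3Tab L M θ) := by
  rw [cubicTab, stiffHolo_action_add, stiffHolo_action_smul]
  ring

/-- Holomorphy of `Z` in the cubic deformation parameter: for every real `K, ε₂` and every torus,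
`ζ ↦ partZ K (cubicTab ε₂ ζ) L M` is complex differentiable on all of `ℂ`. -/
theorem differentiable_partZ_cubic (K ε₂ : ℝ) (L M : ℕ) [NeZero L] [NeZero M] :
    Differentiable ℂ (fun ζ : ℂ => partZ K (cubicTab ε₂ ζ) L M) := by
  have hK : IsCompact (cube L M) := isCompact_univ_pi fun _ => isCompact_Icc
  have h := stiffHolo_differentiable_setIntegral_exp_neg_affine (μ := volume) hK
    (A₀ := fun θ : Λ L M → ℝ =>
      action K (spatialTab + (1 : ℂ) • temporalCosTab + (Complex.I * ε₂) • temporalSinTab) L M θ)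
    (A₁ := fun θ : Λ L M → ℝ => Complex.I * action K temporalSin3Tab L M θ)
    (stiffHolo_continuous_action K _ L M)
    (by have h1 := stiffHolo_continuous_action K temporalSin3Tab L M; fun_prop)
  simp only [partZ, action_cubicTab_eq]
  exact h

/-- Exponential-in-`M` a-priori bound for tables with `normA c ≤ B`:
`‖Z_M‖ ≤ exp (M · |(ℤ/L)²| · (B|K| + log 2π))`. [folklore] -/
theorem norm_partZ_le_exp_of_normA_le {r : ℕ} (K : ℝ) (c : Table r) {B : ℝ} (hc : normA c ≤ B)
    (L M : ℕ) [NeZero L] [NeZero M] :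
    ‖partZ K c L M‖ ≤
      Real.exp ((Fintype.card (TorusSite 2 L) * (B * |K| + Real.log (2 * Real.pi))) * M) := by
  have h := norm_partZ_le K c L M
  rw [card_Λ] at h
  have hpi : (0 : ℝ) < 2 * Real.pi := by positivity
  have hpow : (2 * Real.pi) ^ (Fintype.card (TorusSite 2 L) * M)
      = Real.exp ((Fintype.card (TorusSite 2 L) * M : ℕ) * Real.log (2 * Real.pi)) := by
    rw [Real.exp_nat_mul, Real.exp_log hpi]
  rw [hpow, ← Real.exp_add] at h
  refine h.trans (Real.exp_le_exp.mpr ?_)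
  have hN : (0 : ℝ) ≤ ((Fintype.card (TorusSite 2 L) * M : ℕ) : ℝ) := by positivity
  push_cast
  have : |K| * (↑(Fintype.card (TorusSite 2 L)) * ↑M) * normA c
      ≤ |K| * (↑(Fintype.card (TorusSite 2 L)) * ↑M) * B := by
    apply mul_le_mul_of_nonneg_left hc
    positivity
  nlinarith [this, abs_nonneg K]

end

end Summit.HubbardSuperconductivity.BirComplexStableXYNegative
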